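import Mathlib
import Summits.CriticalPhenomena.PercolationContinuityZ3.Theorems.PercNearOneGluingAdditiveGluingSigmaRecursion
import Summits.CriticalPhenomena.PercolationContinuityZ3.Theorems.PercNearOneGluingAdditiveGluingSigmaLaw
import Summits.CriticalPhenomena.PercolationContinuityZ3.Theorems.PercNearOneGluingAdditiveGluingSigmaGeometry
import HarnessLib

/-!
# Crux `PercNearOneGluing.NoHeavyLowerTail` (stmt-CriticalPhenomena-4575), line `bhk-superadditivity-thinning` —
# stub `blockLayerDecomposition`: layer-decomposition identities of the glued block

Lead prover-line-stmt-CriticalPhenomena-4575-c5-0, 2026-08-16.  Proves exactly the registered stub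
signature `blockLayerDecomposition`; lands with `--supports stmt-CriticalPhenomena-4575`.

## Content

Finite weighted graph on `Fin n`, weights `w : Sym2 (Fin n) → unitInterval`, an observer block `O`
contracted: `μ := prodBernoulli (glue w O)` with
`glue w O e = if (∀ x ∈ e, x ∈ O) ∧ ¬ e.IsDiag then 1 else w e` (weight `1` on the non-loop pairs
inside `O`).  For a finite set `S` let

* `L_S := {ω | ∀ x, x ∈ S ↔ (x ∉ O ∧ ∃ o ∈ O, s(o, x) ∈ ω)}` ("the open layer of `O` is `S`"),
* `P'_S := prodBernoulli (glue (kill w O) S)`, i.e. the weights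
  `fun e => if (∀ x ∈ e, x ∈ S) ∧ ¬ e.IsDiag then 1 else if (∃ x ∈ e, x ∈ O) then 0 else w e`
  (the block `O` deleted, the layer `S` contracted).

For `A` disjoint from `O` and `a, b ∉ O` the stub records the bookkeeping of the Kozma–Nitzan
σ-recursion (arXiv:2401.12397, §3.2) in block form:

1. `Σ_S μ(L_S) = 1`;
2. `μ(L_S) ≠ 0 → ∀ x ∈ S, x ∉ O ∧ ∃ o ∈ O, w s(o, x) ≠ 0` (positive layers);
3. `μ(O ↔ A) = Σ_S μ(L_S) · P'_S(S ↔ A)`;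
4. `μ(O ↔ b) = Σ_S μ(L_S) · P'_S(S ↔ b)`;
5. `μ(a ↔ b) = Σ_S μ(L_S) · P'_S(a ↔ b)`.

## Proof

These identities are proved inside `sigmaRec_engine`
(`…AdditiveGluingSigmaRecursion.lean`), which only exports a combined inequality; here they are
re-derived verbatim in abstract form (`blockLayerDecomposition_engine`: glued weights `p`, layer
weights `q S`, off-block/glued configuration map `Ψ S`, conull clique event `K`, with the geometry
and the law of the decomposition as hypotheses) from the public helpers `sigmaRec_conull`,
`sigmaRec_inter_congr`, `sigmaRec_partition`, `sigmaRec_posLayer`, and then instantiated exactly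
as in `stub_sigmaRecursion`: `p := glue w O`, `q S := glue (kill w O) S`,
`Ψ S ω := {e | e ∈ ω ∧ ∀ x ∈ e, x ∉ O} ∪ {e | (∀ x ∈ e, x ∈ S) ∧ ¬ e.IsDiag}`,
`K := {ω | ∀ o ∈ O, ∀ o' ∈ O, o ≠ o' → s(o, o') ∈ ω}`; the geometry is `stub_sigmaGeometry`
(clause (1) with `X := A` and `X := {b}`, clause (2) with `u := a`, `v := b`) and the law is
`stub_sigmaLaw`.
-/

namespace Summit.CriticalPhenomena.PercolationContinuityZ3.Theorems

open MeasureTheory Set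
open Literature.Probability.LatticeModels (prodBernoulli)
open Literature.Probability.Percolation (BondConfig openConn openGraph)

noncomputable section
open Classical

variable {n : ℕ}

/-- **Layer decomposition, abstract form.**  `p` = glued weights, `q S` = weights of the
block-deleted graph with the layer `S` glued, `Ψ S` = the off-block/glued configuration map,
`K` = the conull clique event; the geometry (`hgeoA`, `hgeob`, `hgeoab`) and the law (`hlaw`) of
the decomposition are hypotheses.  Conclusion: the five identities of the module docstring
(the `have` blocks of `sigmaRec_engine`, exported).
[folklore; Kozma–Nitzan arXiv:2401.12397 §3.2] -/
theorem blockLayerDecomposition_engine (w p : Sym2 (Fin n) → unitInterval)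
    (q : Finset (Fin n) → Sym2 (Fin n) → unitInterval) (O A : Finset (Fin n)) (b a : Fin n)
    (Ψ : Finset (Fin n) → BondConfig (Fin n) → BondConfig (Fin n)) (K : Set (BondConfig (Fin n)))
    (hK : ∀ ω, ω ∉ K → ∃ e, p e = 1 ∧ e ∉ ω)
    (hpO : ∀ o x : Fin n, x ∉ O → p s(o, x) = w s(o, x))
    (hgeoA : ∀ (S : Finset (Fin n)) (ω : BondConfig (Fin n)),
      (∀ x : Fin n, x ∈ S ↔ (x ∉ O ∧ ∃ o ∈ O, s(o, x) ∈ ω)) → ω ∈ K →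
      (ω ∈ (⋃ o ∈ O, ⋃ x ∈ A, openConn o x) ↔ Ψ S ω ∈ (⋃ s ∈ S, ⋃ x ∈ A, openConn s x)))
    (hgeob : ∀ (S : Finset (Fin n)) (ω : BondConfig (Fin n)),
      (∀ x : Fin n, x ∈ S ↔ (x ∉ O ∧ ∃ o ∈ O, s(o, x) ∈ ω)) → ω ∈ K →
      (ω ∈ (⋃ o ∈ O, openConn o b) ↔ Ψ S ω ∈ (⋃ s ∈ S, openConn s b)))
    (hgeoab : ∀ (S : Finset (Fin n)) (ω : BondConfig (Fin n)),
      (∀ x : Fin n, x ∈ S ↔ (x ∉ O ∧ ∃ o ∈ O, s(o, x) ∈ ω)) → ω ∈ K →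
      (ω ∈ openConn a b ↔ Ψ S ω ∈ openConn a b))
    (hlaw : ∀ (S : Finset (Fin n)) (E : Set (BondConfig (Fin n))),
      (prodBernoulli p).real
          ({ω | ∀ x : Fin n, x ∈ S ↔ (x ∉ O ∧ ∃ o ∈ O, s(o, x) ∈ ω)} ∩ {ω | Ψ S ω ∈ E}) =
        (prodBernoulli p).real {ω | ∀ x : Fin n, x ∈ S ↔ (x ∉ O ∧ ∃ o ∈ O, s(o, x) ∈ ω)} *
          (prodBernoulli (q S)).real E) :
    (∑ S : Finset (Fin n),
        (prodBernoulli p).real {ω | ∀ x : Fin n, x ∈ S ↔ (x ∉ O ∧ ∃ o ∈ O, s(o, x) ∈ ω)} = 1) ∧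
    (∀ S : Finset (Fin n),
        (prodBernoulli p).real {ω | ∀ x : Fin n, x ∈ S ↔ (x ∉ O ∧ ∃ o ∈ O, s(o, x) ∈ ω)} ≠ 0 →
        ∀ x ∈ S, x ∉ O ∧ ∃ o ∈ O, w s(o, x) ≠ 0) ∧
    (prodBernoulli p).real (⋃ o ∈ O, ⋃ x ∈ A, openConn o x) =
      ∑ S : Finset (Fin n),
        (prodBernoulli p).real {ω | ∀ x : Fin n, x ∈ S ↔ (x ∉ O ∧ ∃ o ∈ O, s(o, x) ∈ ω)} *
          (prodBernoulli (q S)).real (⋃ s ∈ S, ⋃ x ∈ A, openConn s x) ∧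
    (prodBernoulli p).real (⋃ o ∈ O, openConn o b) =
      ∑ S : Finset (Fin n),
        (prodBernoulli p).real {ω | ∀ x : Fin n, x ∈ S ↔ (x ∉ O ∧ ∃ o ∈ O, s(o, x) ∈ ω)} *
          (prodBernoulli (q S)).real (⋃ s ∈ S, openConn s b) ∧
    (prodBernoulli p).real (openConn a b) =
      ∑ S : Finset (Fin n),
        (prodBernoulli p).real {ω | ∀ x : Fin n, x ∈ S ↔ (x ∉ O ∧ ∃ o ∈ O, s(o, x) ∈ ω)} *
          (prodBernoulli (q S)).real (openConn a b) := by
  have hKc : prodBernoulli p Kᶜ = 0 := sigmaRec_conull p K hK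
  -- factorisation of `μ(L_S ∩ F)` for an event `F` that is `Ψ_S⁻¹ F'` on `L_S ∩ K`
  have hfac : ∀ (S : Finset (Fin n)) (F F' : Set (BondConfig (Fin n))),
      (∀ ω : BondConfig (Fin n), (∀ x : Fin n, x ∈ S ↔ (x ∉ O ∧ ∃ o ∈ O, s(o, x) ∈ ω)) →
        ω ∈ K → (ω ∈ F ↔ Ψ S ω ∈ F')) →
      (prodBernoulli p).real
          ({ω | ∀ x : Fin n, x ∈ S ↔ (x ∉ O ∧ ∃ o ∈ O, s(o, x) ∈ ω)} ∩ F) =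
        (prodBernoulli p).real {ω | ∀ x : Fin n, x ∈ S ↔ (x ∉ O ∧ ∃ o ∈ O, s(o, x) ∈ ω)} *
          (prodBernoulli (q S)).real F' := by
    intro S F F' hFF'
    rw [← hlaw S F']
    exact sigmaRec_inter_congr p hKc fun ω hL hKω => hFF' ω hL hKω
  refine ⟨?_, fun S hS0 => sigmaRec_posLayer w p O S hpO hS0, ?_, ?_, ?_⟩
  · -- total mass of the layer partition
    have h := sigmaRec_partition p O Set.univ
    simp only [Set.inter_univ, probReal_univ] at h
    exact h.symm
  · -- `{O ↔ A}`
    rw [sigmaRec_partition p O]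
    exact Finset.sum_congr rfl fun S _ => hfac S _ _ (hgeoA S)
  · -- `{O ↔ b}`
    rw [sigmaRec_partition p O]
    exact Finset.sum_congr rfl fun S _ => hfac S _ _ (hgeob S)
  · -- `{a ↔ b}`
    rw [sigmaRec_partition p O]
    exact Finset.sum_congr rfl fun S _ => hfac S _ _ (hgeoab S)

/-- **Block layer decomposition** (registered stub `blockLayerDecomposition` of crux
stmt-CriticalPhenomena-4575, line `bhk-superadditivity-thinning`).  For weights `w` on the pairs
of `Fin n`, a block `O`, a set `A` disjoint from `O` and vertices `a, b ∉ O`, with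
`μ := prodBernoulli (glue w O)`, `L_S := {layer of O = S}` and `P'_S := prodBernoulli
(glue (kill w O) S)`: `Σ_S μ(L_S) = 1`; `μ(L_S) ≠ 0` forces `∀ x ∈ S, x ∉ O ∧ ∃ o ∈ O,
w s(o,x) ≠ 0`; and `μ(O ↔ A) = Σ_S μ(L_S) P'_S(S ↔ A)`, `μ(O ↔ b) = Σ_S μ(L_S) P'_S(S ↔ b)`,
`μ(a ↔ b) = Σ_S μ(L_S) P'_S(a ↔ b)`.  Proof: `blockLayerDecomposition_engine` instantiated with
the glued weights, the off-block/glued configuration map, the clique event, `stub_sigmaGeometry`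
and `stub_sigmaLaw` (as in `stub_sigmaRecursion`). [folklore; Kozma–Nitzan arXiv:2401.12397 §3.2] -/
theorem blockLayerDecomposition : ∀ (n : ℕ) (w : Sym2 (Fin n) → unitInterval) (O A : Finset (Fin n)) (a b : Fin n), Disjoint O A → b ∉ O → a ∉ O → (∑ S : Finset (Fin n), (Literature.Probability.LatticeModels.prodBernoulli (fun e : Sym2 (Fin n) => if (∀ x ∈ e, x ∈ O) ∧ ¬ e.IsDiag then 1 else w e)).real {ω : Literature.Probability.Percolation.BondConfig (Fin n) | ∀ x : Fin n, x ∈ S ↔ (x ∉ O ∧ ∃ o ∈ O, s(o, x) ∈ ω)} = 1) ∧ (∀ S : Finset (Fin n), (Literature.Probability.LatticeModels.prodBernoulli (fun e : Sym2 (Fin n) => if (∀ x ∈ e, x ∈ O) ∧ ¬ e.IsDiag then 1 else w e)).real {ω : Literature.Probability.Percolation.BondConfig (Fin n) | ∀ x : Fin n, x ∈ S ↔ (x ∉ O ∧ ∃ o ∈ O, s(o, x) ∈ ω)} ≠ 0 → ∀ x ∈ S, x ∉ O ∧ ∃ o ∈ O, w s(o, x) ≠ 0) ∧ (Literature.Probability.LatticeModels.prodBernoulli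 (fun e : Sym2 (Fin n) => if (∀ x ∈ e, x ∈ O) ∧ ¬ e.IsDiag then 1 else w e)).real (⋃ o ∈ O, ⋃ x ∈ A, Literature.Probability.Percolation.openConn o x) = ∑ S : Finset (Fin n), (Literature.Probability.LatticeModels.prodBernoulli (fun e : Sym2 (Fin n) => if (∀ x ∈ e, x ∈ O) ∧ ¬ e.IsDiag then 1 else w e)).real {ω : Literature.Probability.Percolation.BondConfig (Fin n) | ∀ x : Fin n, x ∈ S ↔ (x ∉ O ∧ ∃ o ∈ O, s(o, x) ∈ ω)} * (Literature.Probability.LatticeModels.prodBernoulli (fun e : Sym2 (Fin n) => if (∀ x ∈ e, x ∈ S) ∧ ¬ e.IsDiag then 1 else if (∃ x ∈ e, x ∈ O) then 0 else w e)).real (⋃ s ∈ S, ⋃ x ∈ A, Literature.Probability.Percolation.openConn s x) ∧ (Literature.Probability.LatticeModels.prodBernoulli (fun e : Sym2 (Fin n) => if (∀ x ∈ e, x ∈ O) ∧ ¬ e.IsDiag then 1 else w e)).real (⋃ o ∈ O, Literature.Probability.Percolation.openConn o b) = ∑ S : Finset (Fin n), (Literature.Probability.LatticeModels.prodBernoulli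 (fun e : Sym2 (Fin n) => if (∀ x ∈ e, x ∈ O) ∧ ¬ e.IsDiag then 1 else w e)).real {ω : Literature.Probability.Percolation.BondConfig (Fin n) | ∀ x : Fin n, x ∈ S ↔ (x ∉ O ∧ ∃ o ∈ O, s(o, x) ∈ ω)} * (Literature.Probability.LatticeModels.prodBernoulli (fun e : Sym2 (Fin n) => if (∀ x ∈ e, x ∈ S) ∧ ¬ e.IsDiag then 1 else if (∃ x ∈ e, x ∈ O) then 0 else w e)).real (⋃ s ∈ S, Literature.Probability.Percolation.openConn s b) ∧ (Literature.Probability.LatticeModels.prodBernoulli (fun e : Sym2 (Fin n) => if (∀ x ∈ e, x ∈ O) ∧ ¬ e.IsDiag then 1 else w e)).real (Literature.Probability.Percolation.openConn a b) = ∑ S : Finset (Fin n), (Literature.Probability.LatticeModels.prodBernoulli (fun e : Sym2 (Fin n) => if (∀ x ∈ e, x ∈ O) ∧ ¬ e.IsDiag then 1 else w e)).real {ω : Literature.Probability.Percolation.BondConfig (Fin n) | ∀ x : Fin n, x ∈ S ↔ (x ∉ O ∧ ∃ o ∈ O, s(o, x) ∈ ω)} * (Literature.Probability.LatticeModels.prodBernoulli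 (fun e : Sym2 (Fin n) => if (∀ x ∈ e, x ∈ S) ∧ ¬ e.IsDiag then 1 else if (∃ x ∈ e, x ∈ O) then 0 else w e)).real (Literature.Probability.Percolation.openConn a b) := by
  intro n w O A a b hOA hb ha
  refine blockLayerDecomposition_engine w
    (fun e : Sym2 (Fin n) => if (∀ x ∈ e, x ∈ O) ∧ ¬ e.IsDiag then 1 else w e)
    (fun (S : Finset (Fin n)) (e : Sym2 (Fin n)) =>
      if (∀ x ∈ e, x ∈ S) ∧ ¬ e.IsDiag then 1 else if (∃ x ∈ e, x ∈ O) then 0 else w e)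
    O A b a
    (fun (S : Finset (Fin n)) (ω : BondConfig (Fin n)) =>
      {e | e ∈ ω ∧ ∀ x ∈ e, x ∉ O} ∪ {e | (∀ x ∈ e, x ∈ S) ∧ ¬ e.IsDiag})
    {ω | ∀ o ∈ O, ∀ o' ∈ O, o ≠ o' → s(o, o') ∈ ω} ?_ ?_ ?_ ?_ ?_ (stub_sigmaLaw n w O)
  · -- outside the clique event some weight-1 pair is closed
    intro ω hω
    simp only [Set.mem_setOf_eq] at hω
    push Not at hω
    obtain ⟨o, ho, o', ho', hne, hnot⟩ := hω
    refine ⟨s(o, o'), ?_, hnot⟩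
    show (if (∀ y ∈ s(o, o'), y ∈ O) ∧ ¬ (s(o, o')).IsDiag then (1 : unitInterval)
      else w s(o, o')) = 1
    rw [if_pos]
    refine ⟨fun y hy => ?_, fun hd => hne (Sym2.mk_isDiag_iff.1 hd)⟩
    rcases Sym2.mem_iff.1 hy with rfl | rfl
    · exact ho
    · exact ho'
  · -- the glued weight of a pair leaving `O` is the original weight
    intro o x hx
    show (if (∀ y ∈ s(o, x), y ∈ O) ∧ ¬ (s(o, x)).IsDiag then (1 : unitInterval)
      else w s(o, x)) = w s(o, x)
    rw [if_neg]
    rintro ⟨h, -⟩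
    exact hx (h x (Sym2.mem_mk_right o x))
  · -- geometry of `{O ↔ A}`
    intro S ω hL hK
    exact (stub_sigmaGeometry n O S ω hL hK).1 A hOA
  · -- geometry of `{O ↔ b}`
    intro S ω hL hK
    have h := (stub_sigmaGeometry n O S ω hL hK).1 {b} (Finset.disjoint_singleton_right.2 hb)
    simpa only [Finset.set_biUnion_singleton] using h
  · -- geometry of `{a ↔ b}`
    intro S ω hL hK
    exact (stub_sigmaGeometry n O S ω hL hK).2 a b ha hb

end

end Summit.CriticalPhenomena.PercolationContinuityZ3.Theorems
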